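import Mathlib
import Summits.Ventures.DiscreteObjects.Mahler.DobrowolskiAsymptotics
import Summits.Ventures.DiscreteObjects.Mahler.DobrowolskiWeak

/-!
# Dobrowolski's theorem `M(f) ≥ 1 + c (log log d / log d)³` (venture `DiscreteObjects`, target L)

Cell `pub-namedobj`, seat `pub-namedobj-mahler-g27`. Framing: lottery ticket; floor = certified bounds/negative ranges.

[cite: MckeeSmyth2021, Theorem 3.1] (Dobrowolski 1979, Acta Arith. 34; proof of Cantor–Straus 1982 as printed in §3.2):
**there is an absolute constant `c > 0` such that every monic irreducible `f ∈ ℤ[X]` with `M(f) > 1` and degree `d`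
satisfies `M(f) ≥ 1 + c · (log log d / log d)³`** (`dobrowolski`; for `d ≤ 2` the right side is `≤ 1` and the
statement is empty).  KERNEL REPLICATION, end to end: nondegenerate `f` of large degree by `DobrowolskiAsymptotics`
(confluent Vandermonde / Hadamard / Dobrowolski's Lemma / Chebyshev); degenerate `f` (two distinct roots with a common
power) descend to a lower degree with the same measure bound by [cite: MckeeSmyth2021, Lemma 3.8]
(`DobrowolskiClassReduction.exists_irreducible_of_lower_degree`), using that `(log log d/log d)³` is decreasing for
`d ≥ 16`; small degrees by the weak bound `1 + 1/(22d)` (`DobrowolskiWeak`).  Corollaries: `dobrowolski_of_irreducible`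
(not necessarily monic), `dobrowolski_of_measure_gt_one` (**every `P ∈ ℤ[X]` with `M(P) > 1`**), `dobrowolski_algInt`
(the printed element form: a nonzero algebraic integer `α` of degree `d`, not a root of unity, has
`M(α) ≥ 1 + c (log log d/log d)³`).  The constant is not made explicit (the printed `2 - ε` / Dobrowolski's `1 - ε`
need the Prime Number Theorem; the tree's Chebyshev-strength inputs give `1/2000` at large nondegenerate degrees).
No new mathematics.
-/

namespace Summit.Ventures.DiscreteObjects.Mahler

open Polynomial

/-- `r ≤ 1 ⇒ r³ ≤ 1`. -/
theorem pow_three_le_one_of_le_one {r : ℝ} (h : r ≤ 1) : r ^ 3 ≤ 1 := by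
  nlinarith [sq_nonneg (r + 1 / 2), mul_nonneg (sub_nonneg.2 h) (add_nonneg (sq_nonneg (r + 1 / 2))
    (by norm_num : (0 : ℝ) ≤ 3 / 4))]

/-- The Dobrowolski exponent `(log log d / log d)³` is at most `1`. -/
theorem dobrowolskiShape_le_one (d : ℕ) : (Real.log (Real.log d) / Real.log d) ^ 3 ≤ 1 := by
  apply pow_three_le_one_of_le_one
  rcases eq_or_lt_of_le (Real.log_natCast_nonneg d) with h | h
  · rw [← h]; simp
  · rw [div_le_one h]
    exact (Real.log_le_sub_one_of_pos h).trans (by linarith)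

/-- The Dobrowolski shape is decreasing in the degree from `16` on. -/
theorem dobrowolskiShape_antitone {e d : ℕ} (he : 16 ≤ e) (hed : e ≤ d) :
    (Real.log (Real.log d) / Real.log d) ^ 3 ≤ (Real.log (Real.log e) / Real.log e) ^ 3 := by
  have he' : (16 : ℝ) ≤ e := by exact_mod_cast he
  have hed' : (e : ℝ) ≤ d := by exact_mod_cast hed
  have hle : Real.log 16 ≤ Real.log e := Real.log_le_log (by norm_num) he'
  have hlede : Real.log e ≤ Real.log d := Real.log_le_log (by linarith) hed'
  -- `exp 1 ≤ log 16` (also in `Literature.NumberTheory.LFunctions.TypicalOrdinateLevelSets`; re-derived inline)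
  have h16 : Real.exp 1 ≤ Real.log 16 := by
    have h1 : Real.log 16 = 4 * Real.log 2 := by
      rw [show (16 : ℝ) = 2 ^ 4 by norm_num, Real.log_pow]; norm_num
    rw [h1]
    have h2 := Real.exp_one_lt_d9
    have h3 := Real.log_two_gt_d9
    linarith
  have hmem_e : Real.log e ∈ Set.Ici (Real.exp 1) := h16.trans hle
  have hmem_d : Real.log d ∈ Set.Ici (Real.exp 1) := h16.trans (hle.trans hlede)
  have h := Real.log_div_self_antitoneOn hmem_e hmem_d hlede
  have h0 : 0 ≤ Real.log (Real.log d) / Real.log d := by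
    apply div_nonneg (Real.log_nonneg _) (le_trans (Real.exp_pos 1).le hmem_d)
    exact le_trans (by have := Real.exp_one_gt_d9; linarith) hmem_d
  exact pow_le_pow_left₀ h0 h 3

/-- **Dobrowolski's theorem** [cite: MckeeSmyth2021, Theorem 3.1] (Dobrowolski 1979), kernel form with an unspecified
absolute constant: there is `c > 0` such that every monic irreducible `f ∈ ℤ[X]` with `M(f) > 1` and degree `d` has
`M(f) ≥ 1 + c (log log d / log d)³`. -/
theorem dobrowolski : ∃ c : ℝ, 0 < c ∧ ∀ f : ℤ[X], f.Monic → Irreducible f → 1 < intMahlerMeasure f →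
    1 + c * (Real.log (Real.log f.natDegree) / Real.log f.natDegree) ^ 3 ≤ intMahlerMeasure f := by
  classical
  obtain ⟨U₀, hU⟩ := dobrowolski_of_nondegenerate
  set D₁ : ℕ := max 16 ⌈Real.exp U₀⌉₊ with hD₁
  have hD16 : 16 ≤ D₁ := le_max_left _ _
  have hDlog : ∀ d : ℕ, D₁ ≤ d → U₀ ≤ Real.log d := by
    intro d hd
    have h1 : Real.exp U₀ ≤ d :=
      (Nat.le_ceil _).trans (by exact_mod_cast (le_max_right 16 _).trans hd)
    calc U₀ = Real.log (Real.exp U₀) := (Real.log_exp _).symm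
      _ ≤ Real.log d := Real.log_le_log (Real.exp_pos _) h1
  set c : ℝ := min (1 / 2000) (1 / (22 * D₁)) with hc
  have hD₁pos : (0 : ℝ) < D₁ := by exact_mod_cast lt_of_lt_of_le (by norm_num) hD16
  have hcpos : 0 < c := lt_min (by norm_num) (by positivity)
  have hc1 : c ≤ 1 / 2000 := min_le_left _ _
  have hc2 : c ≤ 1 / (22 * D₁) := min_le_right _ _
  refine ⟨c, hcpos, ?_⟩
  -- small degrees: the weak bound beats `c`
  have hsmall : ∀ g : ℤ[X], Irreducible g → 1 < intMahlerMeasure g → g.natDegree < D₁ →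
      ∀ d : ℕ, 1 + c * (Real.log (Real.log d) / Real.log d) ^ 3 ≤ intMahlerMeasure g := by
    intro g hgirr hMg hgd d
    have hw := weakDobrowolski_of_irreducible hgirr hMg
    rcases Nat.eq_zero_or_pos g.natDegree with h0 | hpos
    · -- impossible branch in practice; the weak bound reads `1 + 1/0 = 1 < M`
      have : c * (Real.log (Real.log d) / Real.log d) ^ 3 ≤ c * 1 :=
        mul_le_mul_of_nonneg_left (dobrowolskiShape_le_one d) hcpos.le
      rw [h0] at hw
      norm_num at hw
      -- `M g ≥ 2` for a constant of measure `> 1`? use instead `c ≤ 1/(22 D₁) ≤ 1/(22·1)` and `1 + 1/22 < M`? not available;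
      -- fall back: `M(g) > 1` and `c φ ≤ c ≤ 1/(22 D₁)`; we need `1/(22 D₁) ≤ M g - 1`: from `g = C a`, `|a| ≥ 2`.
      have hgC : g = C (g.coeff 0) := eq_C_of_natDegree_eq_zero h0
      have h2 : (2 : ℝ) ≤ intMahlerMeasure g := by
        rw [hgC, intMahlerMeasure_C] at hMg ⊢
        have h1 : (1 : ℤ) < |g.coeff 0| := by exact_mod_cast hMg
        have : (2 : ℤ) ≤ |g.coeff 0| := h1
        exact_mod_cast this
      have hc3 : c ≤ 1 := hc1.trans (by norm_num)
      linarith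
    · have h1 : 1 / (22 * (g.natDegree : ℝ)) ≥ 1 / (22 * (D₁ : ℝ)) := by
        apply one_div_le_one_div_of_le (by positivity)
        have : (g.natDegree : ℝ) ≤ D₁ := by exact_mod_cast hgd.le
        linarith
      have : c * (Real.log (Real.log d) / Real.log d) ^ 3 ≤ c * 1 :=
        mul_le_mul_of_nonneg_left (dobrowolskiShape_le_one d) hcpos.le
      linarith
  -- strong induction on the degree
  suffices hmain : ∀ n : ℕ, ∀ f : ℤ[X], f.natDegree = n → f.Monic → Irreducible f → 1 < intMahlerMeasure f →
      1 + c * (Real.log (Real.log n) / Real.log n) ^ 3 ≤ intMahlerMeasure f by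
    intro f hmon hirr hM
    exact hmain _ f rfl hmon hirr hM
  intro n
  induction n using Nat.strong_induction_on with
  | _ n ih =>
    intro f hfn hmon hirr hM
    by_cases hn : n < D₁
    · exact hsmall f hirr hM (hfn ▸ hn) n
    push Not at hn
    by_cases hnd : ∀ a ∈ (f.map (Int.castRingHom ℂ)).roots, ∀ b ∈ (f.map (Int.castRingHom ℂ)).roots, a ≠ b →
        ∀ m : ℕ, 0 < m → a ^ m ≠ b ^ m
    · -- nondegenerate: the analytic bound
      have h := hU f hmon hirr hM hnd (hfn ▸ hDlog n hn)
      rw [hfn] at h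
      have hM0 : 0 < intMahlerMeasure f := lt_trans zero_lt_one hM
      have hexp := Real.add_one_le_exp (Real.log (intMahlerMeasure f))
      rw [Real.exp_log hM0] at hexp
      have hφ0 : 0 ≤ (Real.log (Real.log n) / Real.log n) ^ 3 := by
        apply pow_nonneg
        have hn16 : (16 : ℝ) ≤ n := by exact_mod_cast hD16.trans hn
        have hlogn : 1 ≤ Real.log n := by
          have h4 : Real.log 16 ≤ Real.log n := Real.log_le_log (by norm_num) hn16
          have h1 : Real.log 16 = 4 * Real.log 2 := by
            rw [show (16 : ℝ) = 2 ^ 4 by norm_num, Real.log_pow]; norm_num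
          have h3 := Real.log_two_gt_d9
          linarith
        exact div_nonneg (Real.log_nonneg hlogn) (by linarith)
      have : c * (Real.log (Real.log n) / Real.log n) ^ 3 ≤ 1 / 2000 * (Real.log (Real.log n) / Real.log n) ^ 3 :=
        mul_le_mul_of_nonneg_right hc1 hφ0
      linarith
    · -- degenerate: descend by Lemma 3.8
      push Not at hnd
      obtain ⟨a, ha, b, hb, hab, m, hm, heq⟩ := hnd
      have h0 : f.coeff 0 ≠ 0 := by
        intro h0
        have h1 := measure_eq_one_of_irreducible_of_dvd hirr (X_dvd_iff.mpr h0) Polynomial.not_isUnit_X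
          intMahlerMeasure_X
        linarith
      obtain ⟨g, hgmon, hgirr, -, hMg1, hMgle, hdeglt⟩ :=
        exists_irreducible_of_lower_degree f hmon hirr h0 hM ha hb hab ⟨m, hm, heq⟩
      by_cases hgd : g.natDegree < D₁
      · exact (hsmall g hgirr hMg1 hgd n).trans hMgle
      · push Not at hgd
        have ih' := ih g.natDegree (hfn ▸ hdeglt) g rfl hgmon hgirr hMg1
        have hmono := dobrowolskiShape_antitone (hD16.trans hgd) (hfn ▸ hdeglt.le)
        have : c * (Real.log (Real.log n) / Real.log n) ^ 3 ≤
            c * (Real.log (Real.log g.natDegree) / Real.log g.natDegree) ^ 3 :=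
          mul_le_mul_of_nonneg_left hmono hcpos.le
        linarith

/-- **Dobrowolski's theorem for every irreducible `f ∈ ℤ[X]` with `M(f) > 1`** (not necessarily monic). -/
theorem dobrowolski_of_irreducible : ∃ c : ℝ, 0 < c ∧ ∀ f : ℤ[X], Irreducible f → 1 < intMahlerMeasure f →
    1 + c * (Real.log (Real.log f.natDegree) / Real.log f.natDegree) ^ 3 ≤ intMahlerMeasure f := by
  obtain ⟨c, hcpos, hc⟩ := dobrowolski
  refine ⟨min c 1, lt_min hcpos one_pos, fun f hirr hM => ?_⟩
  have hshape := dobrowolskiShape_le_one f.natDegree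
  by_cases hlc : 2 ≤ |f.leadingCoeff|
  · have h := abs_leadingCoeff_le_intMahlerMeasure f
    have h2 : (2 : ℝ) ≤ |(f.leadingCoeff : ℝ)| := by exact_mod_cast hlc
    have : min c 1 * (Real.log (Real.log f.natDegree) / Real.log f.natDegree) ^ 3 ≤ min c 1 * 1 :=
      mul_le_mul_of_nonneg_left hshape (lt_min hcpos one_pos).le
    have : min c 1 ≤ 1 := min_le_right _ _
    linarith
  have hf0 : f ≠ 0 := hirr.ne_zero
  have hlc1 : f.leadingCoeff = 1 ∨ f.leadingCoeff = -1 := by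
    have hne : f.leadingCoeff ≠ 0 := leadingCoeff_ne_zero.mpr hf0
    have hnn := abs_nonneg f.leadingCoeff
    rcases abs_choice f.leadingCoeff with h | h <;> rw [h] at hlc hnn <;> omega
  obtain ⟨g, hgmon, hgirr, hgM, hgdeg⟩ : ∃ g : ℤ[X], g.Monic ∧ Irreducible g ∧
      intMahlerMeasure g = intMahlerMeasure f ∧ g.natDegree = f.natDegree := by
    rcases hlc1 with h1 | h1
    · exact ⟨f, h1, hirr, rfl, rfl⟩
    · refine ⟨-f, by rw [Monic, leadingCoeff_neg, h1, neg_neg], ?_, intMahlerMeasure_neg f, natDegree_neg f⟩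
      have hassoc : Associated f (-f) := ⟨-1, by simp⟩
      exact hassoc.irreducible hirr
  rw [← hgM, ← hgdeg]
  rw [← hgM] at hM
  have h := hc g hgmon hgirr hM
  rcases le_or_gt 0 ((Real.log (Real.log g.natDegree) / Real.log g.natDegree) ^ 3) with hpos | hneg
  · have : min c 1 * (Real.log (Real.log g.natDegree) / Real.log g.natDegree) ^ 3 ≤
        c * (Real.log (Real.log g.natDegree) / Real.log g.natDegree) ^ 3 :=
      mul_le_mul_of_nonneg_right (min_le_left _ _) hpos
    linarith
  · have : min c 1 * (Real.log (Real.log g.natDegree) / Real.log g.natDegree) ^ 3 ≤ 0 :=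
      mul_nonpos_of_nonneg_of_nonpos (lt_min hcpos one_pos).le hneg.le
    linarith

/-- **Dobrowolski's theorem for every `P ∈ ℤ[X]` with `M(P) > 1`**: `M(P) ≥ 1 + c (log log D / log D)³`, `D = deg P`,
for an absolute constant `c > 0` (via an irreducible factor of measure `> 1`). -/
theorem dobrowolski_of_measure_gt_one : ∃ c : ℝ, 0 < c ∧ ∀ P : ℤ[X], 1 < intMahlerMeasure P →
    1 + c * (Real.log (Real.log P.natDegree) / Real.log P.natDegree) ^ 3 ≤ intMahlerMeasure P := by
  classical
  obtain ⟨c, hcpos, hc⟩ := dobrowolski_of_irreducible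
  refine ⟨min c (1 / 352), lt_min hcpos (by norm_num), fun P hM => ?_⟩
  set c' := min c (1 / 352) with hc'
  have hc'pos : 0 < c' := lt_min hcpos (by norm_num)
  have hP : P ≠ 0 := by
    intro h
    rw [h] at hM
    unfold intMahlerMeasure at hM
    rw [Polynomial.map_zero, mahlerMeasure_zero] at hM
    linarith
  obtain ⟨u, hu⟩ := UniqueFactorizationMonoid.factors_prod hP
  obtain ⟨k, hk, hku⟩ := Polynomial.isUnit_iff.mp u.isUnit
  set F := UniqueFactorizationMonoid.factors P with hF
  have hFirr : ∀ f ∈ F, Irreducible f := fun f hf => UniqueFactorizationMonoid.irreducible_of_factor f hf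
  have hMu : intMahlerMeasure (↑u : ℤ[X]) = 1 := by
    rw [← hku, intMahlerMeasure_C]
    rcases Int.isUnit_iff.mp hk with h | h <;> simp [h]
  have hMp : intMahlerMeasure P = (F.map intMahlerMeasure).prod := by
    rw [← hu, intMahlerMeasure_mul, hMu, mul_one, intMahlerMeasure_multiset_prod]
  have hdvd : ∀ f ∈ F, f ∣ P := fun f hf => (Multiset.dvd_prod hf).trans ⟨↑u, hu.symm⟩
  have hge1 : ∀ x ∈ F.map intMahlerMeasure, 1 ≤ x := by
    intro x hx
    obtain ⟨f, hf, rfl⟩ := Multiset.mem_map.mp hx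
    exact one_le_intMahlerMeasure (hFirr f hf).ne_zero
  have hprod_ge : ∀ x ∈ F.map intMahlerMeasure, x ≤ (F.map intMahlerMeasure).prod := by
    intro x hx
    obtain ⟨T, hT⟩ := Multiset.exists_cons_of_mem hx
    rw [hT, Multiset.prod_cons]
    have hT1 : 1 ≤ T.prod :=
      Multiset.one_le_prod (fun y hy => hge1 y (by rw [hT]; exact Multiset.mem_cons_of_mem hy))
    have hx0 : 0 ≤ x := le_trans zero_le_one (hge1 x hx)
    nlinarith
  have hex : ∃ f ∈ F, 1 < intMahlerMeasure f := by
    by_contra hall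
    push Not at hall
    have h1 : ∀ x ∈ F.map intMahlerMeasure, x = 1 := by
      intro x hx
      obtain ⟨f, hf, rfl⟩ := Multiset.mem_map.mp hx
      exact le_antisymm (hall f hf) (hge1 _ hx)
    have : (F.map intMahlerMeasure).prod = 1 := Multiset.prod_eq_one h1
    rw [← hMp] at this
    linarith
  obtain ⟨f, hf, hfM⟩ := hex
  have hfle : intMahlerMeasure f ≤ intMahlerMeasure P := by
    rw [hMp]
    exact hprod_ge _ (Multiset.mem_map_of_mem _ hf)
  have hfdeg : f.natDegree ≤ P.natDegree := natDegree_le_of_dvd (hdvd f hf) hP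
  have hshapeP := dobrowolskiShape_le_one P.natDegree
  by_cases hfd : f.natDegree < 16
  · -- small factor degree: the weak bound `1 + 1/(22·deg f) ≥ 1 + 1/352`
    have hw := weakDobrowolski_of_irreducible (hFirr f hf) hfM
    rcases Nat.eq_zero_or_pos f.natDegree with hd0 | hdpos
    · have hfC : f = C (f.coeff 0) := eq_C_of_natDegree_eq_zero hd0
      have h2 : (2 : ℝ) ≤ intMahlerMeasure f := by
        rw [hfC, intMahlerMeasure_C] at hfM ⊢
        have h1 : (1 : ℤ) < |f.coeff 0| := by exact_mod_cast hfM
        have : (2 : ℤ) ≤ |f.coeff 0| := h1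
        exact_mod_cast this
      have : c' * (Real.log (Real.log P.natDegree) / Real.log P.natDegree) ^ 3 ≤ c' * 1 :=
        mul_le_mul_of_nonneg_left hshapeP hc'pos.le
      have : c' ≤ 1 / 352 := min_le_right _ _
      linarith
    · have h1 : 1 / (352 : ℝ) ≤ 1 / (22 * (f.natDegree : ℝ)) := by
        apply one_div_le_one_div_of_le (by positivity)
        have : (f.natDegree : ℝ) ≤ 16 := by exact_mod_cast hfd.le
        linarith
      have : c' * (Real.log (Real.log P.natDegree) / Real.log P.natDegree) ^ 3 ≤ c' * 1 :=
        mul_le_mul_of_nonneg_left hshapeP hc'pos.le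
      have : c' ≤ 1 / 352 := min_le_right _ _
      linarith
  · push Not at hfd
    have h := hc f (hFirr f hf) hfM
    have hmono := dobrowolskiShape_antitone hfd hfdeg
    rcases le_or_gt 0 ((Real.log (Real.log P.natDegree) / Real.log P.natDegree) ^ 3) with hpos | hneg
    · have : c' * (Real.log (Real.log P.natDegree) / Real.log P.natDegree) ^ 3 ≤
          c * (Real.log (Real.log f.natDegree) / Real.log f.natDegree) ^ 3 :=
        (mul_le_mul_of_nonneg_right (min_le_left _ _) hpos).trans (mul_le_mul_of_nonneg_left hmono hcpos.le)
      linarith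
    · have : c' * (Real.log (Real.log P.natDegree) / Real.log P.natDegree) ^ 3 ≤ 0 :=
        mul_nonpos_of_nonneg_of_nonpos hc'pos.le hneg.le
      linarith

/-- **[MckeeSmyth2021, Theorem 3.1] as printed**: there is an absolute `c > 0` such that every nonzero algebraic
integer `α` of degree `d` that is not a root of unity has `M(α) ≥ 1 + c (log log d / log d)³` — here `α ∈ ℂ` integral
over `ℤ`, `M(α) = M(minpoly_ℤ α)`, `d = deg minpoly_ℤ α`. -/
theorem dobrowolski_algInt : ∃ c : ℝ, 0 < c ∧ ∀ α : ℂ, IsIntegral ℤ α → α ≠ 0 → (∀ n : ℕ, 0 < n → α ^ n ≠ 1) →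
    1 + c * (Real.log (Real.log (minpoly ℤ α).natDegree) / Real.log (minpoly ℤ α).natDegree) ^ 3 ≤
      intMahlerMeasure (minpoly ℤ α) := by
  obtain ⟨c, hcpos, hc⟩ := dobrowolski
  refine ⟨c, hcpos, fun α hα hα0 hnu => ?_⟩
  have hw := weakDobrowolski_algInt hα hα0 hnu
  have hM : 1 < intMahlerMeasure (minpoly ℤ α) := by
    have : (0 : ℝ) < 1 / (22 * ((minpoly ℤ α).natDegree : ℝ)) := by
      have := minpoly.natDegree_pos hα
      positivity
    linarith
  exact hc _ (minpoly.monic hα) (minpoly.irreducible hα) hM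

/-- **The house of an algebraic integer (Schinzel–Zassenhaus direction)** [cite: MckeeSmyth2021, Theorem 3.1 with
§3.3/Prop. 4.4]: there is `c > 0` such that every monic irreducible `f ∈ ℤ[X]` with `M(f) > 1` and degree `d` has a
complex root of modulus `≥ 1 + (c/d) (log log d / log d)³` (from `M(f) ≤ house(f)^d`). -/
theorem dobrowolski_house : ∃ c : ℝ, 0 < c ∧ ∀ f : ℤ[X], f.Monic → Irreducible f → 1 < intMahlerMeasure f →
    ∃ z ∈ (f.map (Int.castRingHom ℂ)).roots,
      1 + c / f.natDegree * (Real.log (Real.log f.natDegree) / Real.log f.natDegree) ^ 3 ≤ ‖z‖ := by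
  classical
  obtain ⟨c, hcpos, hc⟩ := dobrowolski
  refine ⟨min c 1 / 2, by positivity, fun f hmon hirr hM => ?_⟩
  obtain ⟨z, hz, hz1, hmax⟩ := exists_root_norm_gt_one hmon hM
  refine ⟨z, hz, ?_⟩
  set d := f.natDegree with hd
  set φ := (Real.log (Real.log d) / Real.log d) ^ 3 with hφ
  have hdpos : 0 < d := natDegree_pos_of_one_lt_measure hmon hM
  have hdR : (0 : ℝ) < d := by exact_mod_cast hdpos
  set RC := (f.map (Int.castRingHom ℂ)).roots with hRC
  have hcard : RC.card = d := by
    rw [hRC, splits_iff_card_roots.1 (IsAlgClosed.splits _),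
      natDegree_map_eq_of_injective (Int.castRingHom ℂ).injective_int]
  -- `M(f) ≤ ‖z‖^d`
  have hMle : intMahlerMeasure f ≤ ‖z‖ ^ d := by
    have hMf : intMahlerMeasure f = (RC.map fun γ => max 1 ‖γ‖).prod := by
      unfold intMahlerMeasure
      rw [mahlerMeasure_eq_leadingCoeff_mul_prod_roots, (hmon.map (Int.castRingHom ℂ)).leadingCoeff, norm_one,
        one_mul]
    rw [hMf]
    calc (RC.map fun γ => max 1 ‖γ‖).prod ≤ (RC.map fun _ => ‖z‖).prod :=
          Multiset.prod_map_le_prod_map₀ _ _ (fun γ _ => by positivity) (fun γ hγ => max_le hz1.le (hmax γ hγ))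
      _ = ‖z‖ ^ d := by rw [Multiset.map_const', Multiset.prod_replicate, hcard]
  -- `x/2 ≤ log (1 + x) ≤ log M ≤ d log ‖z‖` with `x = min c 1 · φ ≤ 1`
  have hφ1 : φ ≤ 1 := dobrowolskiShape_le_one d
  have hb := hc f hmon hirr hM
  have hM0 : 0 < intMahlerMeasure f := lt_trans zero_lt_one hM
  have hlogM : Real.log (intMahlerMeasure f) ≤ d * Real.log ‖z‖ := by
    rw [← Real.log_pow]
    exact Real.log_le_log hM0 hMle
  have hexp := Real.add_one_le_exp (Real.log ‖z‖)
  rw [Real.exp_log (lt_trans zero_lt_one hz1)] at hexp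
  -- case on the sign of `φ`
  rcases le_or_gt φ 0 with hφ0 | hφ0
  · have : min c 1 / 2 / d * φ ≤ 0 := mul_nonpos_of_nonneg_of_nonpos (by positivity) hφ0
    linarith
  · set x := min c 1 * φ with hx
    have hx0 : 0 < x := mul_pos (lt_min hcpos one_pos) hφ0
    have hx1 : x ≤ 1 := by
      calc x ≤ 1 * φ := mul_le_mul_of_nonneg_right (min_le_right _ _) hφ0.le
        _ ≤ 1 := by linarith
    have hxM : 1 + x ≤ intMahlerMeasure f := by
      have : x ≤ c * φ := mul_le_mul_of_nonneg_right (min_le_left _ _) hφ0.le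
      linarith
    have hlog1 : x / 2 ≤ Real.log (1 + x) := by
      have h := Real.one_sub_inv_le_log_of_pos (show 0 < 1 + x by linarith)
      have : x / 2 ≤ 1 - (1 + x)⁻¹ := by
        rw [show 1 - (1 + x)⁻¹ = x / (1 + x) by field_simp; ring]
        exact div_le_div_of_nonneg_left hx0.le (by linarith) (by linarith)
      linarith
    have hlog2 : Real.log (1 + x) ≤ Real.log (intMahlerMeasure f) := Real.log_le_log (by linarith) hxM
    have hchain : x / 2 ≤ d * Real.log ‖z‖ := by linarith
    have hlogz : x / 2 / d ≤ Real.log ‖z‖ := by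
      rw [div_le_iff₀ hdR]; linarith
    calc 1 + min c 1 / 2 / d * φ = 1 + x / 2 / d := by rw [hx]; ring
      _ ≤ 1 + Real.log ‖z‖ := by linarith
      _ ≤ ‖z‖ := by linarith

end Summit.Ventures.DiscreteObjects.Mahler
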